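/-
Copyright (c) 2026 the pub-hodgecm-mathlib formalisation cell (harness21).  Prover seat hodgecm-mathlib-K2Liu-p13 (g3), Track B «K2-LIT»,
#184♮ = hLiu418 = `stmt-HodgeConjecture-24832`; ROAD Φ (RULING «M-156n»), consumer sheet fa2b1e3a29709f09 row G6-fin — letter (MOD) of
★ `K2LiuIntertwiningDeltaEquivariance.isSiegelDeltaSection_intertwiningDelta`, part A (K2E5-plan (g7) co-deal 2026-09-04T14:52:37Z (A), road (γ) over
★ `K2LiuAdelicLinearModulus`); census `K2/K2Liu-p13/g3/CENSUS-MOD-UnipDeltaConjugationModulusAdelic.K2Liu-p13-g3.md` 7506cbadfdc8c2cc.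
THEOREMS ONLY (no `def`, no `instance`, no named-fact hypothesis, no `sorry`); pattern = ★ `K2LiuSiegelDoubledUnipotentScaling` (the centre) run for the whole Levi.
-/
import Summits.HodgeConjecture.HodgeConjecture.Theorems.K2LiuSiegelDoubledUnipotentScaling   -- ★ the centre scaling: chart, transport, instances
import Summits.HodgeConjecture.HodgeConjecture.Theorems.K2LiuAdelicLinearModulus            -- ★ `map_matrix_conj_eq_smul` (K2E5-p17 (g8))
import Literature.NumberTheory.Automorphic.GodementHeightFloor                              -- ★ `ideleNorm_unitsMap_adeleConj`
import Literature.NumberTheory.Automorphic.AdelicUnitaryGroupDatum                           -- ★ `conjAdele_complexConj`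
import HarnessLib

/-!
# Crux `HLiu418`, ROAD Φ, organ Φ8 (sheet row G6-fin), letter (MOD) part A: THE MODULE OF THE SIEGEL LEVI ON `N_Δ(𝔸)` IN THE CHART —
# `((φ x)⁻¹ · (φ x))_* μ_N = |det x|_𝔸^{n} • μ_N` for EVERY `x ∈ GL_n(𝔸_L)` (the squaring trick of ★ `K2LiuSiegelDoubledUnipotentScaling`, run for the Levi)

Cell `hodgecm-mathlib`, crux item hLiu418 = `stmt-HodgeConjecture-24832` (helper lane, count-neutral).  ★ `exists_haar_conjBy_scaling` computed the module of the
CENTRE `z(eˢ)·1` of the Siegel Levi on the Haar measure of `N_Δ(𝔸)` by the squaring trick: `Ψ X = (υ X, υ(δ′X)) : M_n(𝔸_L) ≃ N_Δ × N_Δ` turns `+` into `·` and a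
scalar dilation into `conj × conj`, so `θ² =` the module of the dilation on `M_n(𝔸_L)`.  The same trick gives the module of the WHOLE Levi once two inputs are in place:
(i) the conjugation law of the unipotent chart for a general Levi element, `(φ x)⁻¹ · υ X · φ x = υ (x⁻¹ X x♯)`, `x♯ = T⁻¹ (c x⁻¹)ᵀ T` — from ★ `levi_mul_unip_mul_levi`
(`m(A′,D′) n(Y) m(A,D) = n(A′ Y D)`) and the NEW ring identity `π(x⁻¹ X x♯) = x⁻¹ π(X) x♯` for the projection `π X = ½(X − T⁻¹ (cX)ᵀ T)` onto the skew matrices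
(§1–§2); (ii) the module of `X ↦ x⁻¹ X x♯` on an additive Haar measure of `M_n(𝔸_L)`, which is ★ `K2LiuAdelicLinearModulus.map_matrix_conj_eq_smul` (K2E5-p17 (g8), over ★
Literature `MatrixAdeleModule`): `(|det x| · |det x♯⁻¹|)^n = |det x|_𝔸^{2n}` (`|det x♯| = |c(det x⁻¹)| = |det x|⁻¹`, ★ `ideleNorm_unitsMap_adeleConj`).
* §1 `negConj_levi_conj`, `proj_levi_conj` (any commutative ring with `⅟2`, involution `σ`, invertible symmetric `σ`-fixed `T`);
* §2 `conjBy_levi_unipotentChart` — the Levi law of ANY map `υ` with the chart's block formula (★ `exists_unipotentChart`'s characterisation, BY VALUE);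
* §3 `exists_squaringChart_levi` — the squaring chart intertwining `X ↦ x⁻¹ X x♯` with `conj × conj` for every `x`;
* §4 **`exists_haar_conjBy_levi`** — a Haar measure `μ_N` on the chart's `N_Δ` with `((φ x)⁻¹ · φ x)_* μ_N = (|det x|_𝔸)^n • μ_N` for every `x ∈ GL_n(𝔸_L)`
  (`|det x|_𝔸 = adelicAbsDet n L x`).  Part B (`K2LiuUnipDeltaConjugationModulusAdelic`) transports this to every Haar measure on ★ `unipDelta` and every
  `p ∈ P_Δ(𝔸)` — the binder `hmod` of ★ `isSiegelDeltaSection_intertwiningDelta` (`modDelta(p)^{2n} = |det_Δ p|_𝔸^{n}`).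
Sources: [Garrett2018, §3.10 (`d(m n m⁻¹) = δ(m) dn`)]; [MoeglinWaldspurger1995, I.1.4, II.1.5–II.1.6]; [HarrisKudlaSweet1996, §1 (1.11)–(1.12)]; [WeilBNT1967, Ch. IV §3].
HONEST LABEL.  Helper lemmas, count-neutral; `HC_CM` is proved only modulo the 7 printed citations (2 remaining named inputs:
hLiu418 = `stmt-HodgeConjecture-24832`, h413 = `stmt-HodgeConjecture-24833`) until rung 0 closes.
-/

set_option autoImplicit false
-- the mandated namespace repeats the single-problem summit's segment (`HodgeConjecture.HodgeConjecture`)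
set_option linter.dupNamespace false

noncomputable section

open scoped Matrix NNReal ENNReal Pointwise
open NumberField IsDedekindDomain MeasureTheory Measure

namespace Summit.HodgeConjecture.HodgeConjecture.Cruxes.HLiu418.K2LiuUnipDeltaLeviModulusChart

open Literature.NumberTheory.GelbartRogawski1991.AdaptedBlocks
open Literature.NumberTheory.Automorphic Literature.NumberTheory.Automorphic.UnitaryGroup
open Literature.NumberTheory.GelbartRogawski1991 Literature.NumberTheory.GelbartRogawski1991.GRConstruction
open Literature.NumberTheory.K2Lit.SiegelDoubled Literature.NumberTheory.GaloisRepresentations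
open UnitaryDualPair
open Summit.HodgeConjecture.HodgeConjecture.Cruxes.HLiu418.K2LiuSiegelDoubledLeviAlgebra
open Summit.HodgeConjecture.HodgeConjecture.Cruxes.HLiu418.K2LiuSiegelDoubledBlkUnitary
open Summit.HodgeConjecture.HodgeConjecture.Cruxes.HLiu418.K2LiuSiegelDoubledLeviMatrix
open Summit.HodgeConjecture.HodgeConjecture.Cruxes.HLiu418.K2LiuSiegelDoubledLeviChart
open Summit.HodgeConjecture.HodgeConjecture.Cruxes.HLiu418.K2LiuSiegelDoubledUnipotentChart
open Summit.HodgeConjecture.HodgeConjecture.Cruxes.HLiu418.K2LiuSiegelDoubledUnipotentScaling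
open Summit.HodgeConjecture.HodgeConjecture.Cruxes.HLiu418.K2LiuSiegelDoubledParabolicReduction (isClosed_siegelDelta)
open Summit.HodgeConjecture.HodgeConjecture.Cruxes.HLiu418.K2LiuAdelicLinearModulus (map_matrix_conj_eq_smul adelicAbsDet_inv)

/-! ## §1 Ring level: `π(A′ X D) = A′ π(X) D` for the Levi pair `(A′, D = T⁻¹ σ(A′)ᵀ T)` -/

section Ring

variable {R : Type*} [CommRing R] {ι : Type*} [Fintype ι] [DecidableEq ι] {σ : R →+* R} {T : Matrix ι ι R}

/-- `σ(D)ᵀ = T A′ T⁻¹` for `D = T⁻¹ σ(A′)ᵀ T` (`T` symmetric, `σ`-fixed, invertible; `σ` an involution). [cite: HarrisKudlaSweet1996, §1 (1.11)] -/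
theorem transpose_map_leviD (hT : IsUnit T.det) (hTσ : T.map σ = T) (hTt : Tᵀ = T) (hσ : ∀ x, σ (σ x) = x) (A' : Matrix ι ι R) :
    ((T⁻¹ * (A'.map σ)ᵀ * T).map σ)ᵀ = T * A' * T⁻¹ := by
  rw [Matrix.map_mul, Matrix.map_mul, map_nonsing_inv_eq hT hTσ, hTσ, Matrix.transpose_map, map_map_of_involutive hσ,
    Matrix.transpose_mul, Matrix.transpose_mul, Matrix.transpose_transpose, hTt, Matrix.transpose_nonsing_inv, hTt, Matrix.mul_assoc]

/-- **`ι(A′ X D) = A′ ι(X) D`** for the skew involution `ι X = −T⁻¹ σ(X)ᵀ T` and the Levi pair `(A′, D = T⁻¹ σ(A′)ᵀ T)`: the conjugation of `N_Δ` by the Levi commutes with `ι`.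
[cite: HarrisKudlaSweet1996, §1 (1.12)] -/
theorem negConj_levi_conj (hT : IsUnit T.det) (hTσ : T.map σ = T) (hTt : Tᵀ = T) (hσ : ∀ x, σ (σ x) = x) (A' X : Matrix ι ι R) :
    -(T⁻¹ * ((A' * X * (T⁻¹ * (A'.map σ)ᵀ * T)).map σ)ᵀ * T) = A' * -(T⁻¹ * (X.map σ)ᵀ * T) * (T⁻¹ * (A'.map σ)ᵀ * T) := by
  rw [Matrix.map_mul, Matrix.map_mul, Matrix.transpose_mul, Matrix.transpose_mul, transpose_map_leviD hT hTσ hTt hσ A']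
  rw [Matrix.mul_neg, Matrix.neg_mul]
  congr 1
  calc T⁻¹ * (T * A' * T⁻¹ * ((X.map σ)ᵀ * (A'.map σ)ᵀ)) * T
      = (T⁻¹ * T) * A' * T⁻¹ * (X.map σ)ᵀ * (A'.map σ)ᵀ * T := by simp only [Matrix.mul_assoc]
    _ = A' * T⁻¹ * (X.map σ)ᵀ * (T * T⁻¹) * (A'.map σ)ᵀ * T := by
        rw [Matrix.nonsing_inv_mul T hT, Matrix.one_mul, Matrix.mul_nonsing_inv T hT, Matrix.mul_one]
    _ = A' * (T⁻¹ * (X.map σ)ᵀ * T) * (T⁻¹ * (A'.map σ)ᵀ * T) := by simp only [Matrix.mul_assoc]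

variable [Invertible (2 : R)]

/-- **`π(A′ X D) = A′ π(X) D`** for `π X = ½(X + ι X)` and the Levi pair `(A′, D = T⁻¹ σ(A′)ᵀ T)`. [cite: HarrisKudlaSweet1996, §1 (1.12)] -/
theorem proj_levi_conj (hT : IsUnit T.det) (hTσ : T.map σ = T) (hTt : Tᵀ = T) (hσ : ∀ x, σ (σ x) = x) (A' X : Matrix ι ι R) :
    ⅟(2 : R) • (A' * X * (T⁻¹ * (A'.map σ)ᵀ * T) + -(T⁻¹ * ((A' * X * (T⁻¹ * (A'.map σ)ᵀ * T)).map σ)ᵀ * T)) =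
      A' * (⅟(2 : R) • (X + -(T⁻¹ * (X.map σ)ᵀ * T))) * (T⁻¹ * (A'.map σ)ᵀ * T) := by
  rw [negConj_levi_conj hT hTσ hTt hσ A' X, Matrix.mul_smul, Matrix.smul_mul, Matrix.mul_add, Matrix.add_mul]

end Ring

/-! ## §2 The Levi law of the unipotent chart -/

section Doubled

variable (L : Type) [Field L] [NumberField L] [IsCMField L]
variable {N M n : ℕ} (e : Fin N × Fin M ≃ Fin n)
  (dV : Fin N → L) (hdV : ∀ i, IsCMField.complexConj L (dV i) = dV i)
  (dW : Fin M → L) (hdW : ∀ i, IsCMField.complexConj L (dW i) = dW i)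

/-- **THE LEVI LAW OF THE UNIPOTENT CHART.**  For the Siegel–Levi chart `(M_Δ, N_Δ, e, φ)` (★ `exists_siegelLeviChart`, through its characterisation) and ANY
`υ : M_n(𝔸_L) → N_Δ` with the block formula of ★ `exists_unipotentChart` (`blk (υ X) = R·(1, π X; 0, 1)·R⁻¹`), conjugating by a Levi element acts on the chart by
`(φ x)⁻¹ · υ X · φ x = υ (x⁻¹ · X · x♯)`, `x♯ = T⁻¹ (c x⁻¹)ᵀ T` (★ `levi_mul_unip_mul_levi` + §1 `proj_levi_conj`). [cite: HarrisKudlaSweet1996, §1 (1.12)] -/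
theorem conjBy_levi_unipotentChart (hdV0 : ∀ i, dV i ≠ 0) (hdW0 : ∀ i, dW i ≠ 0)
    {Mg Ng : Subgroup (siegelDelta L e dV hdV dW hdW : Subgroup (HA L e dV hdV dW hdW))}
    {eMN : ↥Mg × ↥Ng ≃ₜ (siegelDelta L e dV hdV dW hdW : Subgroup (HA L e dV hdV dW hdW))}
    (hS : IsTopSemidirect Mg Ng eMN) (φ : GL (Fin n) (AdeleRing (𝓞 L) L) ≃ₜ* ↥Mg)
    (hφ : ∀ g : GL (Fin n) (AdeleRing (𝓞 L) L),
      blk L e dV hdV dW hdW (((φ g : ↥Mg) : (siegelDelta L e dV hdV dW hdW : Subgroup (HA L e dV hdV dW hdW))) : HA L e dV hdV dW hdW) =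
        cayR (AdeleRing (𝓞 L) L) (Fin n) * Matrix.fromBlocks (g : Matrix (Fin n) (Fin n) (AdeleRing (𝓞 L) L)) 0 0
          (((gramR L e dV hdV dW hdW).map ((algebraMap L (AdeleRing (𝓞 L) L)).comp (algebraMap (Fp L) L)))⁻¹ *
            (((g⁻¹ : GL (Fin n) (AdeleRing (𝓞 L) L)) : Matrix (Fin n) (Fin n) (AdeleRing (𝓞 L) L)).map
              (conjAdele (Fp L) L (IsCMField.complexConj L)))ᵀ *
            (gramR L e dV hdV dW hdW).map ((algebraMap L (AdeleRing (𝓞 L) L)).comp (algebraMap (Fp L) L))) *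
          cayRinv (AdeleRing (𝓞 L) L) (Fin n))
    (υ : Matrix (Fin n) (Fin n) (AdeleRing (𝓞 L) L) → ↥Ng)
    (hυblk : ∀ X, blk L e dV hdV dW hdW (((υ X : ↥Ng) : (siegelDelta L e dV hdV dW hdW : Subgroup (HA L e dV hdV dW hdW))) : HA L e dV hdV dW hdW) =
      cayR (AdeleRing (𝓞 L) L) (Fin n) * Matrix.fromBlocks 1
        (⅟(2 : AdeleRing (𝓞 L) L) • (X + -(((gramR L e dV hdV dW hdW).map ((algebraMap L (AdeleRing (𝓞 L) L)).comp (algebraMap (Fp L) L)))⁻¹ *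
          (X.map (conjAdele (Fp L) L (IsCMField.complexConj L)))ᵀ *
          (gramR L e dV hdV dW hdW).map ((algebraMap L (AdeleRing (𝓞 L) L)).comp (algebraMap (Fp L) L))))) 0 1 *
        cayRinv (AdeleRing (𝓞 L) L) (Fin n))
    (x : GL (Fin n) (AdeleRing (𝓞 L) L)) (X : Matrix (Fin n) (Fin n) (AdeleRing (𝓞 L) L)) :
    hS.conjBy (φ x) (υ X) =
      υ (((x⁻¹ : GL (Fin n) (AdeleRing (𝓞 L) L)) : Matrix (Fin n) (Fin n) (AdeleRing (𝓞 L) L)) * X *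
        (((gramR L e dV hdV dW hdW).map ((algebraMap L (AdeleRing (𝓞 L) L)).comp (algebraMap (Fp L) L)))⁻¹ *
          (((x⁻¹ : GL (Fin n) (AdeleRing (𝓞 L) L)) : Matrix (Fin n) (Fin n) (AdeleRing (𝓞 L) L)).map
            (conjAdele (Fp L) L (IsCMField.complexConj L)))ᵀ *
          (gramR L e dV hdV dW hdW).map ((algebraMap L (AdeleRing (𝓞 L) L)).comp (algebraMap (Fp L) L)))) := by
  set σ : AdeleRing (𝓞 L) L →+* AdeleRing (𝓞 L) L := conjAdele (Fp L) L (IsCMField.complexConj L) with hσdef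
  set T : Matrix (Fin n) (Fin n) (AdeleRing (𝓞 L) L) :=
    (gramR L e dV hdV dW hdW).map ((algebraMap L (AdeleRing (𝓞 L) L)).comp (algebraMap (Fp L) L)) with hTdef
  have hT : IsUnit T.det := isUnit_det_gramRA L e dV hdV dW hdW hdV0 hdW0
  have hTσ : T.map σ = T := gramRA_map_conjAdele L e dV hdV dW hdW
  have hTt : Tᵀ = T := gramRA_transpose L e dV hdV dW hdW
  have hσσ : ∀ y, σ (σ y) = y := conjAdele_conjAdele' L
  have hext : ∀ {a b : ↥Ng}, ((a : (siegelDelta L e dV hdV dW hdW : Subgroup (HA L e dV hdV dW hdW))) : HA L e dV hdV dW hdW) =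
      ((b : (siegelDelta L e dV hdV dW hdW : Subgroup (HA L e dV hdV dW hdW))) : HA L e dV hdV dW hdW) → a = b :=
    fun h => Subtype.ext (Subtype.ext h)
  apply hext
  apply blk_injective L e dV hdV dW hdW
  have hconj : (((hS.conjBy (φ x) (υ X) : ↥Ng) : (siegelDelta L e dV hdV dW hdW : Subgroup (HA L e dV hdV dW hdW))) : HA L e dV hdV dW hdW) =
      (((φ x⁻¹ : ↥Mg) : (siegelDelta L e dV hdV dW hdW : Subgroup (HA L e dV hdV dW hdW))) : HA L e dV hdV dW hdW) *
        (((υ X : ↥Ng) : (siegelDelta L e dV hdV dW hdW : Subgroup (HA L e dV hdV dW hdW))) : HA L e dV hdV dW hdW) *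
        (((φ x : ↥Mg) : (siegelDelta L e dV hdV dW hdW : Subgroup (HA L e dV hdV dW hdW))) : HA L e dV hdV dW hdW) := by
    simp only [IsTopSemidirect.conjBy, map_inv, Subgroup.coe_mul, Subgroup.coe_inv]
  -- `A′ A = 1` and `D′ D = 1` for the two Levi matrices
  have hA : ((x⁻¹ : GL (Fin n) (AdeleRing (𝓞 L) L)) : Matrix (Fin n) (Fin n) (AdeleRing (𝓞 L) L)) *
      (x : Matrix (Fin n) (Fin n) (AdeleRing (𝓞 L) L)) = 1 := Units.inv_mul x
  have hD : T⁻¹ * ((x : Matrix (Fin n) (Fin n) (AdeleRing (𝓞 L) L)).map σ)ᵀ * T *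
      (T⁻¹ * ((((x⁻¹ : GL (Fin n) (AdeleRing (𝓞 L) L)) : Matrix (Fin n) (Fin n) (AdeleRing (𝓞 L) L))).map σ)ᵀ * T) = 1 := by
    rw [leviD_mul hT, hA, leviD_one hT]
  rw [hconj, blk_mul, blk_mul, hφ, hφ, hυblk, hυblk, inv_inv, levi_mul_unip_mul_levi hA hD, proj_levi_conj hT hTσ hTt hσσ]

/-! ## §3 The squaring chart, intertwining the Levi conjugations -/

set_option maxHeartbeats 400000 in
/-- **THE SQUARING CHART FOR THE LEVI** (`dV, dW ≠ 0`).  For the Siegel–Levi chart `(M_Δ, N_Δ, e, φ)` there are a homeomorphism `Ψ : M_n(𝔸_L) ≃ₜ N_Δ × N_Δ`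
turning addition into multiplication and intertwining, for EVERY `x ∈ GL_n(𝔸_L)`, the conjugation `X ↦ x⁻¹ · X · x♯` of `M_n(𝔸_L)` with
`((φ x)⁻¹ · (φ x)) × ((φ x)⁻¹ · (φ x))` (★ `exists_squaringChart` is the centre case). [cite: Garrett2018, §3.10] [cite: HarrisKudlaSweet1996, §1 (1.12)] -/
theorem exists_squaringChart_levi (hdV0 : ∀ i, dV i ≠ 0) (hdW0 : ∀ i, dW i ≠ 0)
    {Mg Ng : Subgroup (siegelDelta L e dV hdV dW hdW : Subgroup (HA L e dV hdV dW hdW))}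
    {eMN : ↥Mg × ↥Ng ≃ₜ (siegelDelta L e dV hdV dW hdW : Subgroup (HA L e dV hdV dW hdW))}
    (hS : IsTopSemidirect Mg Ng eMN) (φ : GL (Fin n) (AdeleRing (𝓞 L) L) ≃ₜ* ↥Mg)
    (hNg : ∀ p : (siegelDelta L e dV hdV dW hdW : Subgroup (HA L e dV hdV dW hdW)),
      p ∈ Ng ↔ blkA (blk L e dV hdV dW hdW (p : HA L e dV hdV dW hdW)) = 1)
    (hNgD : ∀ p : (siegelDelta L e dV hdV dW hdW : Subgroup (HA L e dV hdV dW hdW)),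
      p ∈ Ng → blkD (blk L e dV hdV dW hdW (p : HA L e dV hdV dW hdW)) = 1)
    (hφ : ∀ g : GL (Fin n) (AdeleRing (𝓞 L) L),
      blk L e dV hdV dW hdW (((φ g : ↥Mg) : (siegelDelta L e dV hdV dW hdW : Subgroup (HA L e dV hdV dW hdW))) : HA L e dV hdV dW hdW) =
        cayR (AdeleRing (𝓞 L) L) (Fin n) * Matrix.fromBlocks (g : Matrix (Fin n) (Fin n) (AdeleRing (𝓞 L) L)) 0 0
          (((gramR L e dV hdV dW hdW).map ((algebraMap L (AdeleRing (𝓞 L) L)).comp (algebraMap (Fp L) L)))⁻¹ *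
            (((g⁻¹ : GL (Fin n) (AdeleRing (𝓞 L) L)) : Matrix (Fin n) (Fin n) (AdeleRing (𝓞 L) L)).map
              (conjAdele (Fp L) L (IsCMField.complexConj L)))ᵀ *
            (gramR L e dV hdV dW hdW).map ((algebraMap L (AdeleRing (𝓞 L) L)).comp (algebraMap (Fp L) L))) *
          cayRinv (AdeleRing (𝓞 L) L) (Fin n)) :
    ∃ Ψ : Matrix (Fin n) (Fin n) (AdeleRing (𝓞 L) L) ≃ₜ ↥Ng × ↥Ng, (∀ X Y, Ψ (X + Y) = Ψ X * Ψ Y) ∧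
      ∀ (x : GL (Fin n) (AdeleRing (𝓞 L) L)) (X : Matrix (Fin n) (Fin n) (AdeleRing (𝓞 L) L)),
        Ψ (((x⁻¹ : GL (Fin n) (AdeleRing (𝓞 L) L)) : Matrix (Fin n) (Fin n) (AdeleRing (𝓞 L) L)) * X *
            (((gramR L e dV hdV dW hdW).map ((algebraMap L (AdeleRing (𝓞 L) L)).comp (algebraMap (Fp L) L)))⁻¹ *
              (((x⁻¹ : GL (Fin n) (AdeleRing (𝓞 L) L)) : Matrix (Fin n) (Fin n) (AdeleRing (𝓞 L) L)).map
                (conjAdele (Fp L) L (IsCMField.complexConj L)))ᵀ *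
              (gramR L e dV hdV dW hdW).map ((algebraMap L (AdeleRing (𝓞 L) L)).comp (algebraMap (Fp L) L)))) =
          (hS.conjBy (φ x) (Ψ X).1, hS.conjBy (φ x) (Ψ X).2) := by
  obtain ⟨υ, hυc, hυblk, hυadd, hυB, -⟩ := exists_unipotentChart L e dV hdV dW hdW hdV0 hdW0 hS φ hNg hNgD hφ
  have hlevi := conjBy_levi_unipotentChart L e dV hdV dW hdW hdV0 hdW0 hS φ hφ υ hυblk
  clear hφ hNg
  have hT : IsUnit ((gramR L e dV hdV dW hdW).map ((algebraMap L (AdeleRing (𝓞 L) L)).comp (algebraMap (Fp L) L))).det := isUnit_det_gramRA L e dV hdV dW hdW hdV0 hdW0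
  have hex := exists_complexConj_eq_neg L
  have hδ0 : hex.choose ≠ 0 := hex.choose_spec.1
  have hδc : IsCMField.complexConj L hex.choose = -hex.choose := hex.choose_spec.2
  have hdd' : (algebraMap L (AdeleRing (𝓞 L) L) hex.choose) * (algebraMap L (AdeleRing (𝓞 L) L) hex.choose⁻¹) = 1 := by
    rw [← map_mul, mul_inv_cancel₀ hδ0, map_one]
  have hd'd : (algebraMap L (AdeleRing (𝓞 L) L) hex.choose⁻¹) * (algebraMap L (AdeleRing (𝓞 L) L) hex.choose) = 1 := by rw [mul_comm, hdd']
  have hsd : (conjAdele (Fp L) L (IsCMField.complexConj L)) (algebraMap L (AdeleRing (𝓞 L) L) hex.choose) = -(algebraMap L (AdeleRing (𝓞 L) L) hex.choose) := by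
    rw [← algebraMap_conj, show ((IsCMField.complexConj L : L ≃ₐ[Fp L] L) : L →+* L) hex.choose = IsCMField.complexConj L hex.choose from rfl,
      hδc, map_neg]
  have hsd' : (conjAdele (Fp L) L (IsCMField.complexConj L)) (algebraMap L (AdeleRing (𝓞 L) L) hex.choose⁻¹) = -(algebraMap L (AdeleRing (𝓞 L) L) hex.choose⁻¹) := by
    rw [← algebraMap_conj, show ((IsCMField.complexConj L : L ≃ₐ[Fp L] L) : L →+* L) hex.choose⁻¹ = IsCMField.complexConj L hex.choose⁻¹ from rfl,
      map_inv₀, hδc, inv_neg, map_neg]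
  have hB : ∀ u : ↥Ng, ((blkB (blk L e dV hdV dW hdW ((u : (siegelDelta L e dV hdV dW hdW : Subgroup (HA L e dV hdV dW hdW))) : HA L e dV hdV dW hdW))).map (conjAdele (Fp L) L (IsCMField.complexConj L)))ᵀ * ((gramR L e dV hdV dW hdW).map ((algebraMap L (AdeleRing (𝓞 L) L)).comp (algebraMap (Fp L) L))) +
      ((gramR L e dV hdV dW hdW).map ((algebraMap L (AdeleRing (𝓞 L) L)).comp (algebraMap (Fp L) L))) * blkB (blk L e dV hdV dW hdW ((u : (siegelDelta L e dV hdV dW hdW : Subgroup (HA L e dV hdV dW hdW))) : HA L e dV hdV dW hdW)) = 0 :=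
    fun u => skew_blkB L e dV hdV dW hdW (hNgD _ u.2)
  have hblkB : ∀ X, blkB (blk L e dV hdV dW hdW (((υ X : ↥Ng) : (siegelDelta L e dV hdV dW hdW : Subgroup (HA L e dV hdV dW hdW))) : HA L e dV hdV dW hdW)) =
      ⅟(2 : AdeleRing (𝓞 L) L) • (X + -(((gramR L e dV hdV dW hdW).map ((algebraMap L (AdeleRing (𝓞 L) L)).comp (algebraMap (Fp L) L)))⁻¹ * (X.map (conjAdele (Fp L) L (IsCMField.complexConj L)))ᵀ * ((gramR L e dV hdV dW hdW).map ((algebraMap L (AdeleRing (𝓞 L) L)).comp (algebraMap (Fp L) L))))) :=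
    fun X => by rw [hυblk X]; exact (blk_unip _).2.1
  have hυ0 : υ 0 = 1 := by
    have h := hυadd 0 0
    rw [add_zero] at h
    exact mul_left_cancel (h.symm.trans (mul_one _).symm)
  have hanti : ∀ {d : AdeleRing (𝓞 L) L} (_ : (conjAdele (Fp L) L (IsCMField.complexConj L)) d = -d) {Y : Matrix (Fin n) (Fin n) (AdeleRing (𝓞 L) L)}
      (_ : (Y.map (conjAdele (Fp L) L (IsCMField.complexConj L)))ᵀ * ((gramR L e dV hdV dW hdW).map ((algebraMap L (AdeleRing (𝓞 L) L)).comp (algebraMap (Fp L) L))) + ((gramR L e dV hdV dW hdW).map ((algebraMap L (AdeleRing (𝓞 L) L)).comp (algebraMap (Fp L) L))) * Y = 0), υ (d • Y) = 1 := by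
    intro d hd Y hY
    have hb := hblkB (d • Y)
    rw [proj_smul_of_anti hT hd hY] at hb
    have hu := hυB (υ (d • Y))
    rw [hb, hυ0] at hu
    exact hu.symm
  have hcoec : Continuous fun u : ↥Ng => blkB (blk L e dV hdV dW hdW ((u : (siegelDelta L e dV hdV dW hdW : Subgroup (HA L e dV hdV dW hdW))) : HA L e dV hdV dW hdW)) :=
    (continuous_blkB (R := AdeleRing (𝓞 L) L) (ι := Fin n)).comp
      ((((Units.continuous_val.comp continuous_subtype_val).matrix_submatrix _ _).comp continuous_subtype_val).comp continuous_subtype_val)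
  have hleft : Function.LeftInverse
      (fun q : ↥Ng × ↥Ng => blkB (blk L e dV hdV dW hdW ((q.1 : (siegelDelta L e dV hdV dW hdW : Subgroup (HA L e dV hdV dW hdW))) : HA L e dV hdV dW hdW)) +
        (algebraMap L (AdeleRing (𝓞 L) L) hex.choose) • blkB (blk L e dV hdV dW hdW ((q.2 : (siegelDelta L e dV hdV dW hdW : Subgroup (HA L e dV hdV dW hdW))) : HA L e dV hdV dW hdW)))
      (fun X : Matrix (Fin n) (Fin n) (AdeleRing (𝓞 L) L) => (υ X, υ ((algebraMap L (AdeleRing (𝓞 L) L) hex.choose⁻¹) • X))) := fun X => by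
    change blkB _ + (algebraMap L (AdeleRing (𝓞 L) L) hex.choose) • blkB _ = X
    rw [hblkB, hblkB]
    exact (self_eq_proj_add_smul_proj (T := ((gramR L e dV hdV dW hdW).map ((algebraMap L (AdeleRing (𝓞 L) L)).comp (algebraMap (Fp L) L)))) hsd' hdd' X).symm
  have hright : Function.RightInverse
      (fun q : ↥Ng × ↥Ng => blkB (blk L e dV hdV dW hdW ((q.1 : (siegelDelta L e dV hdV dW hdW : Subgroup (HA L e dV hdV dW hdW))) : HA L e dV hdV dW hdW)) +
        (algebraMap L (AdeleRing (𝓞 L) L) hex.choose) • blkB (blk L e dV hdV dW hdW ((q.2 : (siegelDelta L e dV hdV dW hdW : Subgroup (HA L e dV hdV dW hdW))) : HA L e dV hdV dW hdW)))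
      (fun X : Matrix (Fin n) (Fin n) (AdeleRing (𝓞 L) L) => (υ X, υ ((algebraMap L (AdeleRing (𝓞 L) L) hex.choose⁻¹) • X))) := fun q => by
    obtain ⟨u₁, u₂⟩ := q
    refine Prod.ext ?_ ?_
    · change υ (blkB _ + (algebraMap L (AdeleRing (𝓞 L) L) hex.choose) • blkB _) = u₁
      rw [hυadd, hυB, hanti hsd (hB u₂), mul_one]
    · change υ ((algebraMap L (AdeleRing (𝓞 L) L) hex.choose⁻¹) • (blkB _ + (algebraMap L (AdeleRing (𝓞 L) L) hex.choose) • blkB _)) = u₂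
      rw [smul_add, smul_smul, hd'd, one_smul, hυadd, hanti hsd' (hB u₁), one_mul, hυB]
  refine ⟨⟨⟨fun X => (υ X, υ ((algebraMap L (AdeleRing (𝓞 L) L) hex.choose⁻¹) • X)),
      fun q => blkB (blk L e dV hdV dW hdW ((q.1 : (siegelDelta L e dV hdV dW hdW : Subgroup (HA L e dV hdV dW hdW))) : HA L e dV hdV dW hdW)) +
        (algebraMap L (AdeleRing (𝓞 L) L) hex.choose) • blkB (blk L e dV hdV dW hdW ((q.2 : (siegelDelta L e dV hdV dW hdW : Subgroup (HA L e dV hdV dW hdW))) : HA L e dV hdV dW hdW)),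
      hleft, hright⟩, hυc.prodMk (hυc.comp (continuous_const_smul (algebraMap L (AdeleRing (𝓞 L) L) hex.choose⁻¹))),
      (hcoec.comp continuous_fst).add ((hcoec.comp continuous_snd).const_smul (algebraMap L (AdeleRing (𝓞 L) L) hex.choose))⟩,
    fun X Y => ?_, fun x X => ?_⟩
  · change (υ (X + Y), υ ((algebraMap L (AdeleRing (𝓞 L) L) hex.choose⁻¹) • (X + Y))) =
      (υ X * υ Y, υ ((algebraMap L (AdeleRing (𝓞 L) L) hex.choose⁻¹) • X) * υ ((algebraMap L (AdeleRing (𝓞 L) L) hex.choose⁻¹) • Y))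
    rw [hυadd, smul_add, hυadd]
  · -- the Levi conjugation `X ↦ x⁻¹ X x♯` commutes with the scalar `δ′` and with `υ` through `conjBy (φ x)` (§2)
    have hcomm : (algebraMap L (AdeleRing (𝓞 L) L) hex.choose⁻¹) • (((x⁻¹ : GL (Fin n) (AdeleRing (𝓞 L) L)) : Matrix (Fin n) (Fin n) (AdeleRing (𝓞 L) L)) * X * (((gramR L e dV hdV dW hdW).map ((algebraMap L (AdeleRing (𝓞 L) L)).comp (algebraMap (Fp L) L)))⁻¹ * (((x⁻¹ : GL (Fin n) (AdeleRing (𝓞 L) L)) : Matrix (Fin n) (Fin n) (AdeleRing (𝓞 L) L)).map (conjAdele (Fp L) L (IsCMField.complexConj L)))ᵀ * ((gramR L e dV hdV dW hdW).map ((algebraMap L (AdeleRing (𝓞 L) L)).comp (algebraMap (Fp L) L))))) = ((x⁻¹ : GL (Fin n) (AdeleRing (𝓞 L) L)) : Matrix (Fin n) (Fin n) (AdeleRing (𝓞 L) L)) * ((algebraMap L (AdeleRing (𝓞 L) L) hex.choose⁻¹) • X) * (((gramR L e dV hdV dW hdW).map ((algebraMap L (AdeleRing (𝓞 L) L)).comp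 (algebraMap (Fp L) L)))⁻¹ * (((x⁻¹ : GL (Fin n) (AdeleRing (𝓞 L) L)) : Matrix (Fin n) (Fin n) (AdeleRing (𝓞 L) L)).map (conjAdele (Fp L) L (IsCMField.complexConj L)))ᵀ * ((gramR L e dV hdV dW hdW).map ((algebraMap L (AdeleRing (𝓞 L) L)).comp (algebraMap (Fp L) L)))) := by
      rw [Matrix.mul_smul, Matrix.smul_mul]
    change (υ (((x⁻¹ : GL (Fin n) (AdeleRing (𝓞 L) L)) : Matrix (Fin n) (Fin n) (AdeleRing (𝓞 L) L)) * X * (((gramR L e dV hdV dW hdW).map ((algebraMap L (AdeleRing (𝓞 L) L)).comp (algebraMap (Fp L) L)))⁻¹ * (((x⁻¹ : GL (Fin n) (AdeleRing (𝓞 L) L)) : Matrix (Fin n) (Fin n) (AdeleRing (𝓞 L) L)).map (conjAdele (Fp L) L (IsCMField.complexConj L)))ᵀ * ((gramR L e dV hdV dW hdW).map ((algebraMap L (AdeleRing (𝓞 L) L)).comp (algebraMap (Fp L) L))))), υ ((algebraMap L (AdeleRing (𝓞 L) L) hex.choose⁻¹) • (((x⁻¹ : GL (Fin n) (AdeleRing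 (𝓞 L) L)) : Matrix (Fin n) (Fin n) (AdeleRing (𝓞 L) L)) * X * (((gramR L e dV hdV dW hdW).map ((algebraMap L (AdeleRing (𝓞 L) L)).comp (algebraMap (Fp L) L)))⁻¹ * (((x⁻¹ : GL (Fin n) (AdeleRing (𝓞 L) L)) : Matrix (Fin n) (Fin n) (AdeleRing (𝓞 L) L)).map (conjAdele (Fp L) L (IsCMField.complexConj L)))ᵀ * ((gramR L e dV hdV dW hdW).map ((algebraMap L (AdeleRing (𝓞 L) L)).comp (algebraMap (Fp L) L))))))) =
      (hS.conjBy (φ x) (υ X), hS.conjBy (φ x) (υ ((algebraMap L (AdeleRing (𝓞 L) L) hex.choose⁻¹) • X)))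
    exact Prod.ext (hlevi x X).symm ((congrArg υ hcomm).trans (hlevi x ((algebraMap L (AdeleRing (𝓞 L) L) hex.choose⁻¹) • X)).symm)

/-! ## §4 The module of the whole Levi on a Haar measure of the chart's `N_Δ` -/

/-- `|det x♯|_𝔸 = |det x|_𝔸⁻¹` for the Levi partner `x♯ = T⁻¹ (c x⁻¹)ᵀ T`, as the identity `|det x| · |det x♯| = 1` on any unit `B` with matrix `x♯`
(★ `ideleNorm_unitsMap_adeleConj`: the idele norm is `c`-invariant). [cite: WeilBNT1967, Ch. IV §3] [cite: HarrisKudlaSweet1996, §1 (1.11)] -/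
theorem adelicAbsDet_mul_adelicAbsDet_leviD (hdV0 : ∀ i, dV i ≠ 0) (hdW0 : ∀ i, dW i ≠ 0) (x B : GL (Fin n) (AdeleRing (𝓞 L) L))
    (hB : (B : Matrix (Fin n) (Fin n) (AdeleRing (𝓞 L) L)) =
      ((gramR L e dV hdV dW hdW).map ((algebraMap L (AdeleRing (𝓞 L) L)).comp (algebraMap (Fp L) L)))⁻¹ *
        (((x⁻¹ : GL (Fin n) (AdeleRing (𝓞 L) L)) : Matrix (Fin n) (Fin n) (AdeleRing (𝓞 L) L)).map (conjAdele (Fp L) L (IsCMField.complexConj L)))ᵀ *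
        (gramR L e dV hdV dW hdW).map ((algebraMap L (AdeleRing (𝓞 L) L)).comp (algebraMap (Fp L) L))) :
    adelicAbsDet n L x * adelicAbsDet n L B = 1 := by
  have hT := isUnit_det_gramRA L e dV hdV dW hdW hdV0 hdW0
  -- `det B = c (det x⁻¹)`
  have hdet : Matrix.GeneralLinearGroup.det B =
      Units.map (conjAdele (Fp L) L (IsCMField.complexConj L) : AdeleRing (𝓞 L) L →* AdeleRing (𝓞 L) L) (Matrix.GeneralLinearGroup.det x)⁻¹ := by
    apply Units.ext
    rw [Matrix.GeneralLinearGroup.val_det_apply, hB, Matrix.det_mul, Matrix.det_mul, mul_right_comm, ← Matrix.det_mul,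
      Matrix.nonsing_inv_mul _ hT, Matrix.det_one, one_mul, Matrix.det_transpose, ← RingHom.mapMatrix_apply, ← RingHom.map_det,
      Units.coe_map, MonoidHom.coe_coe, ← map_inv, Matrix.GeneralLinearGroup.val_det_apply]
  change IdeleClassGroup.ideleNorm L (Matrix.GeneralLinearGroup.det x) * IdeleClassGroup.ideleNorm L (Matrix.GeneralLinearGroup.det B) = 1
  rw [hdet, conjAdele_complexConj, Godement.ideleNorm_unitsMap_adeleConj, ← map_mul, mul_inv_cancel, map_one]

set_option maxHeartbeats 400000 in
/-- **THE MODULE OF THE SIEGEL LEVI ON `N_Δ(𝔸)` (chart form).**  For the Siegel–Levi chart `(M_Δ, N_Δ, e, φ)` (★ `exists_siegelLeviChart`, by characterisation) there is a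
Haar measure `μ_N` on `N_Δ` with `((φ x)⁻¹ · φ x)_* μ_N = |det x|_𝔸^{n} • μ_N` for EVERY `x ∈ GL_n(𝔸_L)` (`|det x|_𝔸 = adelicAbsDet n L x`): the squaring chart of §3
transports `μ_N ⊗ μ_N` to an additive Haar measure of `M_n(𝔸_L)`, on which `X ↦ x⁻¹ X x♯` has module `(|det x|·|det x♯|⁻¹)^n = |det x|^{2n}` (★
`K2LiuAdelicLinearModulus.map_matrix_conj_eq_smul`), so `θ² = |det x|^{2n}`. [cite: Garrett2018, §3.10] [cite: MoeglinWaldspurger1995, II.1.5–II.1.6] [cite: WeilBNT1967, Ch. IV §3] -/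
theorem exists_haar_conjBy_levi [MeasurableSpace (HA L e dV hdV dW hdW)] [BorelSpace (HA L e dV hdV dW hdW)]
    (hdV0 : ∀ i, dV i ≠ 0) (hdW0 : ∀ i, dW i ≠ 0)
    {Mg Ng : Subgroup (siegelDelta L e dV hdV dW hdW : Subgroup (HA L e dV hdV dW hdW))}
    {eMN : ↥Mg × ↥Ng ≃ₜ (siegelDelta L e dV hdV dW hdW : Subgroup (HA L e dV hdV dW hdW))}
    (hS : IsTopSemidirect Mg Ng eMN) (φ : GL (Fin n) (AdeleRing (𝓞 L) L) ≃ₜ* ↥Mg)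
    (hNg : ∀ p : (siegelDelta L e dV hdV dW hdW : Subgroup (HA L e dV hdV dW hdW)),
      p ∈ Ng ↔ blkA (blk L e dV hdV dW hdW (p : HA L e dV hdV dW hdW)) = 1)
    (hNgD : ∀ p : (siegelDelta L e dV hdV dW hdW : Subgroup (HA L e dV hdV dW hdW)),
      p ∈ Ng → blkD (blk L e dV hdV dW hdW (p : HA L e dV hdV dW hdW)) = 1)
    (hφ : ∀ g : GL (Fin n) (AdeleRing (𝓞 L) L),
      blk L e dV hdV dW hdW (((φ g : ↥Mg) : (siegelDelta L e dV hdV dW hdW : Subgroup (HA L e dV hdV dW hdW))) : HA L e dV hdV dW hdW) =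
        cayR (AdeleRing (𝓞 L) L) (Fin n) * Matrix.fromBlocks (g : Matrix (Fin n) (Fin n) (AdeleRing (𝓞 L) L)) 0 0
          (((gramR L e dV hdV dW hdW).map ((algebraMap L (AdeleRing (𝓞 L) L)).comp (algebraMap (Fp L) L)))⁻¹ *
            (((g⁻¹ : GL (Fin n) (AdeleRing (𝓞 L) L)) : Matrix (Fin n) (Fin n) (AdeleRing (𝓞 L) L)).map
              (conjAdele (Fp L) L (IsCMField.complexConj L)))ᵀ *
            (gramR L e dV hdV dW hdW).map ((algebraMap L (AdeleRing (𝓞 L) L)).comp (algebraMap (Fp L) L))) *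
          cayRinv (AdeleRing (𝓞 L) L) (Fin n)) :
    ∃ μN : Measure ↥Ng, μN.IsHaarMeasure ∧ ∀ x : GL (Fin n) (AdeleRing (𝓞 L) L),
      μN.map (hS.conjBy (φ x)) = (((adelicAbsDet n L x) ^ n : ℝ≥0) : ℝ≥0∞) • μN := by
  haveI : T2Space (GL (Fin (n + n)) (AdeleRing (𝓞 L) L)) := t2Space_gl (n + n) L
  haveI : LocallyCompactSpace (siegelDelta L e dV hdV dW hdW : Subgroup (HA L e dV hdV dW hdW)) := (isClosed_siegelDelta L e dV hdV dW hdW).locallyCompactSpace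
  haveI : SecondCountableTopology (siegelDelta L e dV hdV dW hdW : Subgroup (HA L e dV hdV dW hdW)) := TopologicalSpace.Subtype.secondCountableTopology _
  haveI : LocallyCompactSpace ↥Mg := hS.isClosed_left.locallyCompactSpace
  haveI : LocallyCompactSpace ↥Ng := hS.isClosed_right.locallyCompactSpace
  haveI : SecondCountableTopology ↥Ng := TopologicalSpace.Subtype.secondCountableTopology _
  have hT := isUnit_det_gramRA L e dV hdV dW hdW hdV0 hdW0
  -- the squaring chart (Levi form)
  obtain ⟨Ψ, hΨadd, hΨm⟩ := exists_squaringChart_levi L e dV hdV dW hdW hdV0 hdW0 hS φ hNg hNgD hφ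
  clear hφ hNg hNgD
  refine ⟨haar, inferInstance, fun x => ?_⟩
  have hθ := hS.map_conjBy_eq_smul (haar : Measure ↥Ng) (φ x)
  rw [hθ]
  obtain ⟨θ, hθdef⟩ : ∃ θ : ℝ≥0, θ = modularCharacter (((φ x : ↥Mg) : (siegelDelta L e dV hdV dW hdW : Subgroup (HA L e dV hdV dW hdW)))) * (modularCharacter (φ x))⁻¹ := ⟨_, rfl⟩
  rw [← hθdef] at hθ ⊢
  suffices hθval : θ = (adelicAbsDet n L x) ^ n by rw [hθval]
  -- the two Levi units acting on `M_n(𝔸_L)`: `A = x⁻¹` and `B` with matrix `x♯`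
  obtain ⟨B, hB⟩ : ∃ B : GL (Fin n) (AdeleRing (𝓞 L) L), (B : Matrix (Fin n) (Fin n) (AdeleRing (𝓞 L) L)) =
      ((gramR L e dV hdV dW hdW).map ((algebraMap L (AdeleRing (𝓞 L) L)).comp (algebraMap (Fp L) L)))⁻¹ *
        (((x⁻¹ : GL (Fin n) (AdeleRing (𝓞 L) L)) : Matrix (Fin n) (Fin n) (AdeleRing (𝓞 L) L)).map (conjAdele (Fp L) L (IsCMField.complexConj L)))ᵀ *
        (gramR L e dV hdV dW hdW).map ((algebraMap L (AdeleRing (𝓞 L) L)).comp (algebraMap (Fp L) L)) := by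
    refine ⟨⟨_, ((gramR L e dV hdV dW hdW).map ((algebraMap L (AdeleRing (𝓞 L) L)).comp (algebraMap (Fp L) L)))⁻¹ *
        ((x : Matrix (Fin n) (Fin n) (AdeleRing (𝓞 L) L)).map (conjAdele (Fp L) L (IsCMField.complexConj L)))ᵀ *
        (gramR L e dV hdV dW hdW).map ((algebraMap L (AdeleRing (𝓞 L) L)).comp (algebraMap (Fp L) L)), ?_, ?_⟩, rfl⟩
    · rw [leviD_mul hT, Units.mul_inv, leviD_one hT]
    · rw [leviD_mul hT, Units.inv_mul, leviD_one hT]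
  have hΨm' : ∀ X, Ψ (((x⁻¹ : GL (Fin n) (AdeleRing (𝓞 L) L)) : Matrix (Fin n) (Fin n) (AdeleRing (𝓞 L) L)) * X *
      (B : Matrix (Fin n) (Fin n) (AdeleRing (𝓞 L) L))) = (hS.conjBy (φ x) (Ψ X).1, hS.conjBy (φ x) (Ψ X).2) := fun X => by
    rw [hB]; exact hΨm x X
  clear hΨm
  haveI : SecondCountableTopology (AdeleRing (𝓞 L) L) := secondCountableTopology_adeleRing L
  haveI : LocallyCompactSpace (AdeleRing (𝓞 L) L) := locallyCompactSpace_adeleRing' L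
  letI : MeasurableSpace (AdeleRing (𝓞 L) L) := borel _
  haveI : BorelSpace (AdeleRing (𝓞 L) L) := ⟨rfl⟩
  letI : MeasurableSpace (Matrix (Fin n) (Fin n) (AdeleRing (𝓞 L) L)) := inferInstanceAs (MeasurableSpace (Fin n → Fin n → AdeleRing (𝓞 L) L))
  haveI : BorelSpace (Matrix (Fin n) (Fin n) (AdeleRing (𝓞 L) L)) := inferInstanceAs (BorelSpace (Fin n → Fin n → AdeleRing (𝓞 L) L))
  haveI : SecondCountableTopology (Matrix (Fin n) (Fin n) (AdeleRing (𝓞 L) L)) := inferInstanceAs (SecondCountableTopology (Fin n → Fin n → AdeleRing (𝓞 L) L))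
  haveI : LocallyCompactSpace (Matrix (Fin n) (Fin n) (AdeleRing (𝓞 L) L)) := inferInstanceAs (LocallyCompactSpace (Fin n → Fin n → AdeleRing (𝓞 L) L))
  haveI : T2Space (AdeleRing (𝓞 L) L) := t2Space_adeleRing L
  haveI : T2Space (Matrix (Fin n) (Fin n) (AdeleRing (𝓞 L) L)) := inferInstanceAs (T2Space (Fin n → Fin n → AdeleRing (𝓞 L) L))
  have hcb : Measurable (hS.conjBy (φ x)) := (hS.continuous_conjBy_right _).measurable
  have hm : Measurable fun X : Matrix (Fin n) (Fin n) (AdeleRing (𝓞 L) L) =>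
      ((x⁻¹ : GL (Fin n) (AdeleRing (𝓞 L) L)) : Matrix (Fin n) (Fin n) (AdeleRing (𝓞 L) L)) * X * (B : Matrix (Fin n) (Fin n) (AdeleRing (𝓞 L) L)) :=
    ((continuous_const.mul continuous_id).mul continuous_const).measurable
  obtain ⟨μV, hμV⟩ : ∃ μV : Measure (Matrix (Fin n) (Fin n) (AdeleRing (𝓞 L) L)), μV = ((haar : Measure ↥Ng).prod haar).map Ψ.symm := ⟨_, rfl⟩
  haveI hV1 : μV.IsAddLeftInvariant := hμV ▸ isAddLeftInvariant_transport (haar : Measure ↥Ng) Ψ hΨadd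
  haveI hV2 : IsFiniteMeasureOnCompacts μV := hμV ▸ isFiniteMeasureOnCompacts_transport (haar : Measure ↥Ng) Ψ
  have hV3 : μV.map (fun X => ((x⁻¹ : GL (Fin n) (AdeleRing (𝓞 L) L)) : Matrix (Fin n) (Fin n) (AdeleRing (𝓞 L) L)) * X *
      (B : Matrix (Fin n) (Fin n) (AdeleRing (𝓞 L) L))) = ((θ : ℝ≥0∞) * θ) • μV :=
    hμV ▸ map_transport_eq_smul (haar : Measure ↥Ng) Ψ hcb hθ hm hΨm'
  -- a reference additive Haar measure on `M_n(𝔸_L)` and ★ the module of `X ↦ x⁻¹ X x♯` on it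
  obtain ⟨μH, hμH⟩ : ∃ μH : Measure (Matrix (Fin n) (Fin n) (AdeleRing (𝓞 L) L)), μH = addHaarMeasure (Classical.arbitrary _) := ⟨_, rfl⟩
  haveI : μH.IsAddHaarMeasure := by rw [hμH]; infer_instance
  haveI : μH.Regular := by rw [hμH]; infer_instance
  have hH : μH.map (fun X => ((x⁻¹ : GL (Fin n) (AdeleRing (𝓞 L) L)) : Matrix (Fin n) (Fin n) (AdeleRing (𝓞 L) L)) * X *
      (B : Matrix (Fin n) (Fin n) (AdeleRing (𝓞 L) L))) = (((adelicAbsDet n L x⁻¹⁻¹ * adelicAbsDet n L B⁻¹) ^ n : ℝ≥0) : ℝ≥0∞) • μH :=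
    map_matrix_conj_eq_smul n L μH x⁻¹ B
  have hκ : μV = addHaarScalarFactor μV μH • μH := isAddLeftInvariant_eq_smul μV μH
  have hV4 : μV.map (fun X => ((x⁻¹ : GL (Fin n) (AdeleRing (𝓞 L) L)) : Matrix (Fin n) (Fin n) (AdeleRing (𝓞 L) L)) * X *
      (B : Matrix (Fin n) (Fin n) (AdeleRing (𝓞 L) L))) = (((adelicAbsDet n L x⁻¹⁻¹ * adelicAbsDet n L B⁻¹) ^ n : ℝ≥0) : ℝ≥0∞) • μV := by
    conv_lhs => rw [hκ]
    rw [Measure.map_smul, hH, smul_comm, ← hκ]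
  -- compare on a compact neighbourhood of `0`
  obtain ⟨Kc, hKc, h0K⟩ := exists_compact_mem_nhds (0 : Matrix (Fin n) (Fin n) (AdeleRing (𝓞 L) L))
  have hpos : μV (interior Kc) ≠ 0 := by
    rw [hκ, Measure.smul_apply, ENNReal.smul_def, smul_eq_mul]
    refine mul_ne_zero ?_ (isOpen_interior.measure_pos μH ⟨0, mem_interior_iff_mem_nhds.2 h0K⟩).ne'
    intro hκ0
    have hzero : μV Set.univ = 0 := by rw [hκ, Measure.smul_apply, ENNReal.smul_def, smul_eq_mul, hκ0, zero_mul]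
    rw [hμV, map_apply Ψ.symm.continuous.measurable MeasurableSet.univ, Set.preimage_univ] at hzero
    exact (isOpen_univ.measure_pos ((haar : Measure ↥Ng).prod haar) Set.univ_nonempty).ne' hzero
  have htop : μV (interior Kc) ≠ ∞ := (lt_of_le_of_lt (measure_mono interior_subset) hKc.measure_lt_top).ne
  have heq : ((θ : ℝ≥0∞) * θ) * μV (interior Kc) = (((adelicAbsDet n L x⁻¹⁻¹ * adelicAbsDet n L B⁻¹) ^ n : ℝ≥0) : ℝ≥0∞) * μV (interior Kc) := by
    have h := congrArg (fun μ : Measure (Matrix (Fin n) (Fin n) (AdeleRing (𝓞 L) L)) => μ (interior Kc)) (hV3.symm.trans hV4)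
    simpa only [Measure.smul_apply, smul_eq_mul] using h
  have hθsq : θ * θ = (adelicAbsDet n L x⁻¹⁻¹ * adelicAbsDet n L B⁻¹) ^ n := by exact_mod_cast (ENNReal.mul_left_inj hpos htop).1 heq
  -- `|det x| · |det B⁻¹| = |det x|²`
  have hprod : adelicAbsDet n L x⁻¹⁻¹ * adelicAbsDet n L B⁻¹ = adelicAbsDet n L x * adelicAbsDet n L x := by
    have h1 := adelicAbsDet_mul_adelicAbsDet_leviD L e dV hdV dW hdW hdV0 hdW0 x B hB
    rw [inv_inv, adelicAbsDet_inv, eq_inv_of_mul_eq_one_right h1, inv_inv]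
  rw [hprod, mul_pow] at hθsq
  exact (pow_left_inj₀ (by positivity) (by positivity) two_ne_zero).1 (by rw [sq, sq, hθsq])

end Doubled

end Summit.HodgeConjecture.HodgeConjecture.Cruxes.HLiu418.K2LiuUnipDeltaLeviModulusChart

end
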